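import Literature.AlgebraicGeometry.Frobenioids.MonoidTransport
import Literature.AlgebraicGeometry.Frobenioids.FactorizationTransport
import Literature.AlgebraicGeometry.Frobenioids.PerfFactorialPerfection
import Literature.AlgebraicGeometry.Frobenioids.RlfStructure
import Literature.AnabelianGeometry.EtaleTheta.TemperedFrobenioid
import Literature.AnabelianGeometry.EtaleTheta.FrdIVocabulary
import Literature.AnabelianGeometry.EtaleTheta.PerfSaturationMonoprime

/-!
# [EtTh] Remark 3.6.4, perfection clause: `Φ^pf` is again perf-factorial — proof

Source: S. Mochizuki, *The étale theta function …* [MochizukiEtTh2009], Remark 3.6.4, PDF p. 79 (printed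
305): "If `Φ`, `C` are as in Definition 3.6, (ii), then it follows from Lemma 3.5 [applied to the submonoid
`Φ ⊆ Φ^{ℝ-log}`] that the respective divisor monoids `Φ^pf`, `Φ^rlf` of `C^pf`, `C^rlf` also satisfy the
conditions of Definition 3.6, (ii)."

The §3 statement file (`TemperedFrobenioidProps.lean`, seat abc-iut-L2-t3) records the perfection
clause as `Remark364` = for every `A`: (1) the perf-saturation of `Φ(A)` in `Φ^{ℝ-log}(A)` is
group-saturated, (2) it is perf-factorial, (3) its base-field part is monoprime. (1) is
`TemperedFrobenioidProofs.lean` (seat abc-iut-L6-t12). THIS FILE proves (2) for the tree's [FrdI]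
vocabulary `treeMonoidVocab` — `TemperedFrobenioid.remark364_isPerfFactorial` — from:
`Φ(A)^pf ≅ perfSaturation Φ(A)` (Lemma 3.5 (i), `P^pf` portion; needs `Φ^{ℝ-log}(A)` perfect, which
holds because it IS a realification: `IsRealificationVia` + `IsPerfFactorial.Rlf.isPerfect`, seat
abc-iut-L1-d2), "`M^pf` is perf-factorial" ([FrdI] Def. 2.4 (i): `PerfectionIsPerfFactorial_holds`,
seat abc-iut-L1-d2) and invariance of "perf-factorial" under isomorphism
(`isPerfFactorial_of_mulEquiv`, assembled here from the transport lemmas of `MonoidTransport.lean` /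
`FactorizationTransport.lean`). Clause (3) needs the printed `ℝ`-subspace structure of `ℝ·Φ₀^cnst`
(audit p407532, F2); it is proved here CONDITIONALLY on root-closure of `cnstR`
(`remark364_isMonoprime_bsFld_of_rootClosed`), so that the one-field repair discharges it. Proof-only (no definitions). Seat abc-iut-L2-d2.
-/

namespace Literature.AnabelianGeometry.EtaleTheta

open CategoryTheory Opposite Literature.AlgebraicGeometry.Frobenioids Function

universe u₀ v₀ u v w

/-! ### "Perf-factorial" is invariant under isomorphisms of monoids -/

/-- **`IsPerfFactorial` transports along `M ≅ M'`** ([FrdI] Def. 2.4 (i) is isomorphism-invariant):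
divisoriality and monoprimality of the `M_𝔭` by `MonoidTransport.lean`, conditions (c), (d) by
`Factorization.Cond.of_mulEquiv`. [cite: MochizukiFrdI2008, Def. 2.4(i) p.47] -/
theorem isPerfFactorial_of_mulEquiv {M M' : Type w} [CommMonoid M] [CommMonoid M'] (e : M ≃* M')
    (h : IsPerfFactorial M) : IsPerfFactorial M' := by
  refine IsPerfFactorial.of_cond (h.isDivisorial.of_mulEquiv e) (fun 𝔭' => ?_)
    (Factorization.Cond.of_mulEquiv (Perfection.congr e) h.cond)
  exact (h.isMonoprime (Primes.congr e.symm 𝔭')).of_mulEquiv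
    (Primes.submonoidCongr e (Primes.congr e.symm 𝔭') 𝔭' (Primes.congr_apply_congr_symm e 𝔭'))

/-- The perf-saturation of a perf-factorial submonoid of a PERFECT monoid is perf-factorial
(`P^pf ≅ perfSaturation P` and "`M^pf` is perf-factorial"). [cite: MochizukiEtTh2009, Rmk 3.6.4 p.79] -/
theorem isPerfFactorial_perfSaturation_of_isPerfect {Q : Type w} [CommMonoid Q] (hQ : IsPerfect Q)
    {P : Submonoid Q} (hP : IsPerfFactorial P) : IsPerfFactorial ↥(perfSaturation P) := by
  obtain ⟨e⟩ := Lemma35.nonempty_perfection_mulEquiv_perfSaturation hQ P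
  exact isPerfFactorial_of_mulEquiv e (PerfectionIsPerfFactorial_holds hP)

/-! ### Remark 3.6.4, clause (2), for the tree's vocabulary -/

namespace TemperedFrobenioid

variable {D₀ : Type u₀} [Category.{v₀} D₀] {T : RealifiedDivisorMonoids (D₀ := D₀) treeMonoidVocab.{w}}
  {D : Type u} [Category.{v} D] {VD : FrdICatStub.{u, v, w} D} (C₀ : TemperedFrobenioid T D VD)

/-- `Φ^{ℝ-log}(A) = Φ₀^ℝ(Y_A)` is perfect: it is a realification (`IsRealificationVia`) and `M^rlf` is
perfect ([FrdI] Def. 2.4 (ii): `ℝ` supports `M^rlf`). [cite: MochizukiEtTh2009, Def 3.6 p.76] -/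
theorem isPerfect_ΦRlog (A : Dᵒᵖ) : IsPerfect (C₀.ΦRlog.obj A) := by
  obtain ⟨h, e, -⟩ := T.isRealification (C₀.baseOp A)
  exact (IsPerfFactorial.Rlf.isPerfect h).of_mulEquiv e.symm

/-- **[EtTh] Remark 3.6.4, perfection clause (2)**: for a tempered Frobenioid over the tree's [FrdI]
vocabulary, the perf-saturation of `Φ(A)` in `Φ^{ℝ-log}(A)` — the divisor monoid of `C^pf` at `A` — is
again perf-factorial. [cite: MochizukiEtTh2009, Rmk 3.6.4 p.79] -/
theorem remark364_isPerfFactorial (A : Dᵒᵖ) : IsPerfFactorial ↥(perfSaturation (C₀.Φ.carrier A)) :=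
  isPerfFactorial_perfSaturation_of_isPerfect (C₀.isPerfect_ΦRlog A) (C₀.isPerfFactorial A)

end TemperedFrobenioid

/-! ### Remark 3.6.4, clause (3), modulo the printed `ℝ`-subspace property of `ℝ·Φ₀^cnst` -/

/-- Perf-saturation commutes with intersecting a ROOT-CLOSED submonoid (`x^n ∈ S ⇒ x ∈ S`).
[cite: MochizukiEtTh2009, Rmk 3.6.4 p.79] -/
theorem perfSaturation_inf_eq_of_rootClosed {Q : Type w} [CommMonoid Q] (P S : Submonoid Q)
    (hS : ∀ (x : Q) (n : ℕ+), x ^ (n : ℕ) ∈ S → x ∈ S) :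
    perfSaturation P ⊓ S = perfSaturation (P ⊓ S) := by
  ext x
  simp only [Submonoid.mem_inf, mem_perfSaturation_iff]
  constructor
  · rintro ⟨⟨n, hn⟩, hx⟩
    exact ⟨n, hn, S.pow_mem hx n⟩
  · rintro ⟨n, hnP, hnS⟩
    exact ⟨⟨n, hnP⟩, hS x n hnS⟩

namespace TemperedFrobenioid

variable {D₀ : Type u₀} [Category.{v₀} D₀] {T : RealifiedDivisorMonoids (D₀ := D₀) treeMonoidVocab.{w}}
  {D : Type u} [Category.{v} D] {VD : FrdICatStub.{u, v, w} D} (C₀ : TemperedFrobenioid T D VD)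

/-- **[EtTh] Remark 3.6.4, perfection clause (3), CONDITIONAL form**: if `ℝ·Φ₀^cnst ⊆ (Φ₀^ℝ)^gp` is
root-closed (`g^n ∈ ℝ·Φ₀^cnst ⇒ g ∈ ℝ·Φ₀^cnst` — automatic for the printed "`ℝ`-vector subspace" of the
uniquely divisible `(Φ₀^ℝ)^gp`, Def 3.6 (i) p.76, but not recorded by the typed data; audit of p407532,
finding F2), then the base-field part of `Φ^pf`, i.e. `perfSaturation Φ(A) ∩ (ℝ·Φ₀^cnst)`, is monoprime:
it equals the perf-saturation of the monoprime `Φ^{bs-fld}(A)` in the perfect monoid `Φ^{ℝ-log}(A)`.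
[cite: MochizukiEtTh2009, Rmk 3.6.4 p.79] -/
theorem remark364_isMonoprime_bsFld_of_rootClosed
    (hroot : ∀ (Y : D₀ᵒᵖ) (g : Algebra.GrothendieckGroup (T.ΦR.obj Y)) (n : ℕ+),
      g ^ (n : ℕ) ∈ T.cnstR Y → g ∈ T.cnstR Y)
    (A : Dᵒᵖ) :
    IsMonoprime ↥(perfSaturation (C₀.Φ.carrier A) ⊓
      (T.cnstR (C₀.baseOp A)).toSubmonoid.comap Algebra.GrothendieckGroup.of) := by
  have hS : ∀ (x : T.ΦR.obj (C₀.baseOp A)) (n : ℕ+),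
      x ^ (n : ℕ) ∈ (T.cnstR (C₀.baseOp A)).toSubmonoid.comap Algebra.GrothendieckGroup.of →
        x ∈ (T.cnstR (C₀.baseOp A)).toSubmonoid.comap Algebra.GrothendieckGroup.of := by
    intro x n hx
    have hx' : Algebra.GrothendieckGroup.of (x ^ (n : ℕ)) ∈ T.cnstR (C₀.baseOp A) := hx
    rw [map_pow] at hx'
    exact hroot _ _ n hx'
  have heq := perfSaturation_inf_eq_of_rootClosed (C₀.Φ.carrier A) _ hS
  exact PerfectionPrimes.isMonoprime_of_mulEquiv (MulEquiv.submonoidCongr heq).symm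
    (Lemma35.isMonoprime_perfSaturation (C₀.isPerfect_ΦRlog A) (C₀.isMonoprime_bsFld A))

end TemperedFrobenioid

end Literature.AnabelianGeometry.EtaleTheta
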